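import Mathlib
import Summits.RiemannHypothesis.RiemannHypothesis.Theorems.JensenPolynomialsDefs
import Literature.NumberTheory.LFunctions.XiMoments

/-! # JensenPolynomialsCumulantDefs — TYPED STATEMENTS of the second layer of route `JensenPolynomials` (D-0019): the
foreseen tenure SPLIT of the ANALYTIC crux `XiGorttwCoeffSmallAnalytic := XiGorttwCoeffSmallFrom rhoWinMin 10⁴` into
C0 (the cumulant identity `CumulantCoeffIdentity γ`: `c_{d,n,j} = (d)_j · e_j(Ũ₃(M),…,Ũ_j(M))`, `M = n + d`, pure algebra
of the window of a real sequence), C1 (THE ξ-statement `XiCumulantEnvelope A N`: `|Ũ_k(M)| ≤ A (k−1)! 2^{k/2} M^{−(k−2)/2}`,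
the `1/n!`-class envelope of the Hermite-frame window cumulants of `γ = xiTaylorCoeff`), C2 (`CumulantEnvelopeSum A ρ N`, the
γ-free summation law) and C2⁺ (`CumulantMajorantSum A ρ N`: ONE numeric sequence of all-plus majorant sums `< 1`).  This file
only NAMES the objects (`windowCumulant`, `hermiteCumulant`, `cumulantCoeff`, `envCap`) and STATES the four `Prop` schemas, in
the tree's vocabulary (`windowSeqDown`, `gorttwDelta`, `gorttwCoeff`, `hermiteTestBound` of `JensenPolynomialsDefs`); the PROVED
glue `C0 → XiDeltaSqPos → C1 → C2⁺ → XiGorttwCoeffSmallFrom rhoWinMin N` is `Theorems/JensenCumulantSplit.lean`.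
Verbatim D-0016 extract of HOME `rh-jensen-theory/JensenTargets.lean` v4.6 §8.10, §8.12 (cell rh-jensen, HUMAN RULING D-0040;
THEORY-JENSEN.md §10.8).  LABELS (ladder rule §5.4): all four statements are RH-FREE (C0, C2, C2⁺ are ξ-free; C1 is a
statement about the explicit reals `γ(n)`, provable or refutable by unconditional asymptotics); nothing here bears on the
truth of RH. -/

noncomputable section
-- D-0017: `Summit.RiemannHypothesis.RiemannHypothesis.…` duplicates the namespace BY DESIGN (single-problem summit).
set_option linter.dupNamespace false

open Polynomial Finset
open scoped Nat

namespace Summit.RiemannHypothesis.RiemannHypothesis.Theorems.JensenPolynomials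

open Literature.NumberTheory.LFunctions

/-- General downward window cumulants `ũ_k(M)`, `k ≥ 1`, of the EGF `Σ_k r̃_k(M) w^k/k!` (moment→cumulant recursion
`ũ_{k+1} = r̃_{k+1} − Σ_{i<k} C(k,i) ũ_{i+1} r̃_{k−i}`; `ũ₀ := 0`, `ũ₁ = r̃₁ = 1`, `ũ₂ = r̃₂ − 1 = −2Δ²`, `ũ₃ = gorttwU3`). -/
def windowCumulant (γ : ℕ → ℝ) (M : ℕ) : ℕ → ℝ
  | 0 => 0
  | k + 1 => windowSeqDown γ M (k + 1) -
      ∑ i : Fin k, (k.choose i.1 : ℝ) * windowCumulant γ M (i.1 + 1) * windowSeqDown γ M (k - i.1)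
  decreasing_by all_goals (have := i.2; omega)

/-- Hermite-frame normalised cumulants `Ũ_k(M) := ũ_k(M)/Δ(M)^k` (`Ũ₃² = gorttwSkewSq`, `q = MŨ₃²`). -/
def hermiteCumulant (γ : ℕ → ℝ) (M : ℕ) (k : ℕ) : ℝ := windowCumulant γ M k / gorttwDelta γ M ^ k

/-- The universal polynomials `e_j(U₃,…,U_j) := [s^j] exp(Σ_{k≥3} U_k s^k/k!)`, via `j·e_j = Σ_{k=3}^{j} U_k/(k−1)! · e_{j−k}`
(`e₀ = 1`, `e₁ = e₂ = 0`, `e₃ = U₃/6`, `e₄ = U₄/24`, `e₅ = U₅/120`, `e₆ = U₆/720 + U₃²/72`, …). -/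
def cumulantCoeff (U : ℕ → ℝ) : ℕ → ℝ
  | 0 => 1
  | j + 1 => (∑ i : Fin (j + 1),
      (if 2 ≤ i.1 then U (i.1 + 1) / ((i.1)! : ℝ) * cumulantCoeff U (j - i.1) else 0)) / ((j : ℝ) + 1)
  decreasing_by all_goals (have := i.2; omega)

/-- **C0 (support, ξ-free algebra; provable now by generating functions, see the module docstring): GORTTW's Hermite
coefficients are the cumulant polynomials, `c_{d,n,j} = (d)_j · e_j(Ũ(M))`, `M = n + d`, `0 ≤ j ≤ d`.** -/
def CumulantCoeffIdentity (γ : ℕ → ℝ) : Prop :=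
  ∀ d n j : ℕ, 3 ≤ d → j ≤ d → 0 < gorttwDeltaSq γ (n + d) → γ (n + d) ≠ 0 → γ (n + d - 1) ≠ 0 →
    gorttwCoeff γ d n j = (d.descFactorial j : ℝ) * cumulantCoeff (hermiteCumulant γ (n + d)) j

/-- **C1 (ξ-input of the ANALYTIC crux; RH-FREE): the `1/n!`-ENVELOPE of `ξ`'s Hermite-frame window cumulants**,
`|Ũ_k(M)| ≤ A·(k−1)!·2^{k/2}·M^{−(k−2)/2}` for `M ≥ N`, `3 ≤ k`, `2k³ < M` (the route's own range of orders).  `k = 3` slice: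
`q(M) ≤ 32A²`.  Measured `A_needed ≤ 0.83` on `10² ≤ M ≤ 1.75·10⁵`, `k ≤ 36` (both lineages).  Label: analytic (effective
tilted-Gaussian/Laplace asymptotics of the window, GORZ-type), zero-free, not a computation. -/
def XiCumulantEnvelope (A : ℝ) (N : ℕ) : Prop :=
  ∀ M k : ℕ, N ≤ M → 3 ≤ k → 2 * k ^ 3 < M →
    |hermiteCumulant xiTaylorCoeff M k| ≤
      A * ((k - 1)! : ℝ) * (2 : ℝ) ^ ((k : ℝ) / 2) / (M : ℝ) ^ (((k : ℝ) - 2) / 2)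

/-- **C2 (γ-FREE summation law of the ANALYTIC crux): for every `d ≥ 3`, `n ≥ max(N, 2d³)` and ANY reals `U_k` inside the
C1 envelope at `M = n + d`, the two weighted ℓ¹ sums of `(d)_j|e_j(U)|` (weights `ρ(d,j)` and `(2/B_d)^j`) are `< 1`.**
Numerics (majorant with every `U_k` at its cap, no signs): table `rhoWin`, `A = 1`: `sup_d 0.939`; `rhoWin` + rows 5–8 opened
at `d ≥ 70/128/180/280`, `A = 17/16`: `sup_d 0.866`; second sum `≤ 0.3` always.  A statement about the universal polynomials
`e_j` and the table only — provable by explicit real analysis (the `Ũ₃`-family sums to `(6/5)((3s−1)eˢ + 1)`-type closed forms,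
`s = A√2·(d³/M)^{1/2}/6 ≤ A/ (3√2)·…`), finitely many `d` by certified evaluation. -/
def CumulantEnvelopeSum (A : ℝ) (ρ : ℕ → ℕ → ℝ) (N : ℕ) : Prop :=
  ∀ (d n : ℕ) (U : ℕ → ℝ), 3 ≤ d → 2 * d ^ 3 ≤ n → N ≤ n →
    (∀ k : ℕ, 3 ≤ k → k ≤ d →
      |U k| ≤ A * ((k - 1)! : ℝ) * (2 : ℝ) ^ ((k : ℝ) / 2) / ((n + d : ℕ) : ℝ) ^ (((k : ℝ) - 2) / 2)) →
    (∑ j ∈ range d, (d.descFactorial (j + 1) : ℝ) * |cumulantCoeff U (j + 1)| * ρ d (j + 1) < 1) ∧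
    (∑ j ∈ range d, (d.descFactorial (j + 1) : ℝ) * |cumulantCoeff U (j + 1)| * (2 / hermiteTestBound d) ^ (j + 1) < 1)

/-- The C1 cap `cap_k(M) := A(k−1)!2^{k/2}M^{−(k−2)/2}`. -/
def envCap (A : ℝ) (M k : ℕ) : ℝ :=
  A * ((k - 1)! : ℝ) * (2 : ℝ) ^ ((k : ℝ) / 2) / (M : ℝ) ^ (((k : ℝ) - 2) / 2)

/-- **C2⁺ (γ-free, ONE sequence of numbers): the all-plus majorant sums at the worst shift `M_d = max(N, 2d³) + d` are `< 1`.** -/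
def CumulantMajorantSum (A : ℝ) (ρ : ℕ → ℕ → ℝ) (N : ℕ) : Prop :=
  ∀ d : ℕ, 3 ≤ d →
    (∑ j ∈ range d, (d.descFactorial (j + 1) : ℝ) *
        cumulantCoeff (envCap A (max N (2 * d ^ 3) + d)) (j + 1) * ρ d (j + 1) < 1) ∧
    (∑ j ∈ range d, (d.descFactorial (j + 1) : ℝ) *
        cumulantCoeff (envCap A (max N (2 * d ^ 3) + d)) (j + 1) * (2 / hermiteTestBound d) ^ (j + 1) < 1)

end Summit.RiemannHypothesis.RiemannHypothesis.Theorems.JensenPolynomials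

end
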